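import Summits.HodgeConjecture.HodgeConjecture.Theses.CurveNetMordellWeil
import Literature.AlgebraicGeometry.HodgeTheory.GysinKernelProofs
import Literature.AlgebraicGeometry.Motives.ComplexPointsOrientation
import HarnessLib

/-!
# Route CurveNetMordellWeil, support item `ComplexOrientationExists` (stmt-HodgeConjecture-2789)

There is an orientation family `μ` (a `ℂ`-orientation of the closed `2n`-manifold `X(ℂ)` for every
smooth projective complex `X` of dimension `n`) satisfying Poincaré duality. Proof: `X(ℂ)` is
`ℂ`-orientable (`Literature.AlgebraicGeometry.Motives.ComplexPoints.isOrientableOver`: the complex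
orientation of the GAGA analytification, Milnor–Stasheff §13 / Hatcher p. 235), so choose one
orientation for every `(n, X, hX)`; and EVERY orientation family satisfies Poincaré duality
(`Literature.AlgebraicGeometry.HodgeTheory.OrientationFamily.hasPoincareDuality`, Hatcher
Thm. 3.30 for the closed manifolds `X(ℂ)`, proved in the tree). Both inputs are theorems of the
tree, so the item closes unconditionally; this discharges the quantifier `∀ μ, μ.HasPoincareDuality
→ …` of the route's Gysin statements in the deciding theorem `closes`.

## References

* [HatcherAT2002] A. Hatcher, Algebraic Topology, CUP 2002, §3.3 Thm. 3.30, p. 235.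
* [FultonYoungTableaux1997] W. Fulton, Young Tableaux, CUP 1997, App. B §B.1 (4).
-/

-- `Summit.HodgeConjecture.HodgeConjecture.Theorems` is the mandated namespace (single-problem summit:
-- Problem = Summit), which `linter.dupNamespace` flags on every declaration; the lakefile turns the
-- linter off tree-wide (weak option), restated here so stand-alone elaboration is warning-free too.
set_option linter.dupNamespace false

namespace Summit.HodgeConjecture.HodgeConjecture.Theorems

open Literature.AlgebraicGeometry

/-- **Complex orientations exist and satisfy Poincaré duality** (route CurveNetMordellWeil,
support item `ComplexOrientationExists`, stmt-HodgeConjecture-2789): there is an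
`OrientationFamily μ` with `μ.HasPoincareDuality`. Witness: a chosen `ℂ`-orientation of each
`X(ℂ)` (`Motives.ComplexPoints.isOrientableOver ℂ hX`); duality by
`HodgeTheory.OrientationFamily.hasPoincareDuality` (Hatcher Thm. 3.30). -/
theorem complexOrientationExists_proof :
    Summit.HodgeConjecture.HodgeConjecture.Theses.CurveNetMordellWeil.ComplexOrientationExists := by
  unfold Summit.HodgeConjecture.HodgeConjecture.Theses.CurveNetMordellWeil.ComplexOrientationExists
  exact ⟨fun _ _ hX ↦ Classical.choice (Motives.ComplexPoints.isOrientableOver ℂ hX),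
    HodgeTheory.OrientationFamily.hasPoincareDuality _⟩

end Summit.HodgeConjecture.HodgeConjecture.Theorems
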